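import Literature.NumberTheory.LFunctions.RodgersTaoAsymptotics
import HarnessLib

/-!
# Rodgers–Tao 2020, proof of Lemma 2.1 (FMP pp. 16–19): the complex wrapper `‖I_t(b,ζ)‖ ≪ e^{Re Φ}`
— node R1 of the R19 reduction (`rodgersTao_H_eq_half_Q_one`)

RH-FREE literature PROOFS (no definitions, no named facts; cell rh-crit, corpus C3, seat rt-t1 g2;
bears_on N-C/N-P (COLUMN 3 DBN)). Node **R1** of rt-lead rulings (39)(c)/(43)(a)/(46)(c)
(rt/STATUS 2026-08-26): the «complex wrapper» in the proof of Lemma 2.1 (= FMP Lemma 4) of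

* B. Rodgers, T. Tao, *The de Bruijn–Newman constant is non-negative*, Forum Math. Pi 8 (2020)
  e6 = arXiv:1801.05914. **Version/pages opened:** arXiv v5 TeX l.425–497 (`rt/src/…v5.tex`)
  = FMP pp. 16–19 (eq. (31) and the `n ≥ 2` tail estimates of p. 19).

> (FMP p. 19, v5 l.480–483) «while from (31) and (23) (and Lemma 2.3 (i)) we have
> `I_t(πn², 9 + y + ix) ≪ exp(Re(tw₀² − ζ/4 − tw₀/2 + ζw₀))`»

i.e. the one-sided consequence of eq. (31) (`rodgersTao_I_asymp`):
`‖I_t(b, ζ)‖ ≤ K · exp(Re(tw₀² − be^{4w₀} + ζw₀))`, `K = 2√(π/8) + 8A` (`A` the constant of (31)),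
valid for `b ≥ 1`, `ζ ∈ Ω` and the saddle point `w₀` of (23), because Lemma 2.3 (i)
(`rodgersTao_saddlePoint`, clause (i): `Re(4be^{4w₀}) ≥ 1`) gives `‖be^{4w₀}‖ ≥ 1/4`, hence
`‖(be^{4w₀})^{−1/2}‖ ≤ 2` and `‖be^{4w₀}‖^{−3/2} ≤ 8`; inserting (23), `Re(be^{4w₀}) =
(Re ζ + 2t Re w₀)/4`, the exponent is the printed real quantity
`Re(tw₀² − ζ/4 − tw₀/2 + ζw₀) = t(α² − β²) − (y + 2tα)/4 + yα − xβ` (`w₀ = α + iβ`, `ζ = y + ix`).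
Stated over the §2 statement module `RodgersTaoAsymptotics.lean` only, with eq. (31) and
Lemma 2.3 as HYPOTHESES (`hI : rodgersTao_I_asymp`, `hS : rodgersTao_saddlePoint`; both are
discharged in `RodgersTaoAsymptoticsProofs.lean`, the final R19 leaf applies the `_holds`), so that
t5's R2 (`RodgersTaoTailSumRegimeTwoProofs.lean`: the regime-(ii) bound on the same `Re Φ`),
t6's R3 (regime (iii)) and t7's R4 (`RodgersTaoTailSumAssemblyProofs.lean`) compose with it.

## Main results (all RH-FREE CONTENT, 0 facts)

* `rodgersTao_norm_I_le_exp_re_of hS hI T₀` — the wrapper with the exponent `Re(tw₀² − be^{4w₀} + ζw₀)`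
  (quantifier prefix of `rodgersTao_I_asymp`: `∃ C'₀, ∀ C' ≥ C'₀, ∀ C, ∃ C''₀ K, ∀ C'' ≥ C''₀,
  ∀ t ∈ [−T₀, 0), ∀ b ≥ 1, ∀ ζ ∈ Ω(C, C', C''), ∀ w₀` in the strip solving (23));
* `rodgersTao_norm_I_le_exp_real_of hS hI T₀` — the same with the exponent in the printed real form
  `t(α² − β²) − (Re ζ + 2tα)/4 + Re ζ·α − Im ζ·β`;
* bookkeeping for the summands `Q_{t,n}` (display after (32), p. 17): `rodgersTao_mem_Omega_shift`
  / `…_shift'` (`ζ_a = a + y + ix ∈ Ω(C + 5, C', C'')` for `0 ≤ a ≤ 9`), `rodgersTao_one_le_pi_mul_sq`,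
  `rodgersTao_pi_mul_sq_cast` (`b = πn²`), `rodgersTao_norm_Q_le` (triangle inequality).

Divergence from print: none in content; the implied constant of `≪` is made explicit (`K`) and
the factor `(be^{4w₀})^{−1/2} ≍ x^{−1/2}` is NOT kept (crude bound `≤ 2`, as on p. 19 where only
the exponent matters for `n ≥ 2`). The private identity `tsw_re_phase_eq` is the same computation
as t5's `rodgersTao_re_phase_of_saddleEq` (R2 module), kept private here so that this module does
not depend on that olean.

WHAT THIS IS NOT: an upper bound for an oscillatory integral inside Rodgers–Tao's RH-free
asymptotic analysis of `H_t`, `t < 0`; nothing here bears on the truth of RH.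
-/

noncomputable section

open Complex Set MeasureTheory
open scoped Real

namespace Literature.NumberTheory.LFunctions

/-- `‖z^{-1/2}‖ = ‖z‖^{-1/2}` (principal branch, `z ≠ 0`). [folklore] -/
private theorem tsw_norm_cpow_neg_half {z : ℂ} (hz : z ≠ 0) :
    ‖z ^ (-(1 / 2 : ℂ))‖ = ‖z‖ ^ (-(1 / 2 : ℝ)) := by
  rw [Complex.norm_cpow_of_ne_zero hz]
  have him : (-(1 / 2 : ℂ)).im = 0 := by simp
  have hre : (-(1 / 2 : ℂ)).re = -(1 / 2 : ℝ) := by simp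
  rw [him, hre, mul_zero, Real.exp_zero, div_one]

/-- `Re(4be^{4w₀}) ≥ 1` gives `‖be^{4w₀}‖ ≥ 1/4`. [folklore] -/
private theorem tsw_quarter_le_norm {b : ℝ} {w₀ : ℂ}
    (h : 1 ≤ (4 * (b : ℂ) * Complex.exp (4 * w₀)).re) :
    1 / 4 ≤ ‖(b : ℂ) * Complex.exp (4 * w₀)‖ := by
  have e : (4 * (b : ℂ) * Complex.exp (4 * w₀)) = 4 * ((b : ℂ) * Complex.exp (4 * w₀)) := by ring
  rw [e] at h
  have h1 : (4 * ((b : ℂ) * Complex.exp (4 * w₀))).re = 4 * ((b : ℂ) * Complex.exp (4 * w₀)).re := by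
    simp
  rw [h1] at h
  have h2 := Complex.re_le_norm ((b : ℂ) * Complex.exp (4 * w₀))
  linarith

/-- The norm bookkeeping: `‖I − c e^Φ B^{-1/2}‖ ≤ A‖e^Φ‖/‖B‖^{3/2}` and `‖B‖ ≥ 1/4` give
`‖I‖ ≤ (2|c| + 8A)‖e^Φ‖`. [folklore] -/
private theorem tsw_norm_le_of_asymp {I Φ B : ℂ} {c A : ℝ} (hA : 0 ≤ A)
    (hB : 1 / 4 ≤ ‖B‖)
    (h : ‖I - (c : ℂ) * Complex.exp Φ * B ^ (-(1 / 2 : ℂ))‖ ≤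
      A * ‖Complex.exp Φ‖ / ‖B‖ ^ (3 / 2 : ℝ)) :
    ‖I‖ ≤ (2 * |c| + 8 * A) * Real.exp Φ.re := by
  have hB0 : 0 < ‖B‖ := lt_of_lt_of_le (by norm_num) hB
  have hBne : B ≠ 0 := norm_pos_iff.1 hB0
  have hE : ‖Complex.exp Φ‖ = Real.exp Φ.re := Complex.norm_exp Φ
  have hE0 : 0 < Real.exp Φ.re := Real.exp_pos _
  -- ‖B^{-1/2}‖ ≤ 2
  have hhalf : ‖B ^ (-(1 / 2 : ℂ))‖ ≤ 2 := by
    rw [tsw_norm_cpow_neg_half hBne, Real.rpow_neg hB0.le]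
    have h4 : (1 / 4 : ℝ) ^ (1 / 2 : ℝ) ≤ ‖B‖ ^ (1 / 2 : ℝ) :=
      Real.rpow_le_rpow (by norm_num) hB (by norm_num)
    have hq : (1 / 4 : ℝ) ^ (1 / 2 : ℝ) = 1 / 2 := by
      rw [show (1 / 4 : ℝ) = (1 / 2) ^ (2 : ℕ) by norm_num, ← Real.rpow_natCast,
        ← Real.rpow_mul (by norm_num)]
      norm_num
    rw [hq] at h4
    have hpos : 0 < ‖B‖ ^ (1 / 2 : ℝ) := Real.rpow_pos_of_pos hB0 _
    rw [inv_le_comm₀ hpos (by norm_num)]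
    linarith
  -- 1/‖B‖^{3/2} ≤ 8
  have h32 : A * ‖Complex.exp Φ‖ / ‖B‖ ^ (3 / 2 : ℝ) ≤ 8 * A * Real.exp Φ.re := by
    have hpos : 0 < ‖B‖ ^ (3 / 2 : ℝ) := Real.rpow_pos_of_pos hB0 _
    have h4 : (1 / 4 : ℝ) ^ (3 / 2 : ℝ) ≤ ‖B‖ ^ (3 / 2 : ℝ) :=
      Real.rpow_le_rpow (by norm_num) hB (by norm_num)
    have hq : (1 / 4 : ℝ) ^ (3 / 2 : ℝ) = 1 / 8 := by
      rw [show (1 / 4 : ℝ) = (1 / 2) ^ (2 : ℕ) by norm_num, ← Real.rpow_natCast,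
        ← Real.rpow_mul (by norm_num)]
      norm_num
    rw [hq] at h4
    rw [hE, div_le_iff₀ hpos]
    have := mul_le_mul_of_nonneg_left h4 (by positivity : 0 ≤ 8 * A * Real.exp Φ.re)
    nlinarith [this, hE0, hA]
  have hmain : ‖(c : ℂ) * Complex.exp Φ * B ^ (-(1 / 2 : ℂ))‖ ≤ 2 * |c| * Real.exp Φ.re := by
    rw [norm_mul, norm_mul, Complex.norm_real, Real.norm_eq_abs, hE]
    have := mul_le_mul_of_nonneg_left hhalf (by positivity : 0 ≤ |c| * Real.exp Φ.re)
    nlinarith [this, hE0, abs_nonneg c]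
  calc ‖I‖ = ‖(I - (c : ℂ) * Complex.exp Φ * B ^ (-(1 / 2 : ℂ))) +
        (c : ℂ) * Complex.exp Φ * B ^ (-(1 / 2 : ℂ))‖ := by rw [sub_add_cancel]
    _ ≤ ‖I - (c : ℂ) * Complex.exp Φ * B ^ (-(1 / 2 : ℂ))‖ +
        ‖(c : ℂ) * Complex.exp Φ * B ^ (-(1 / 2 : ℂ))‖ := norm_add_le _ _
    _ ≤ 8 * A * Real.exp Φ.re + 2 * |c| * Real.exp Φ.re := add_le_add (h.trans h32) hmain
    _ = (2 * |c| + 8 * A) * Real.exp Φ.re := by ring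

/-- The real part of the phase at a solution of (23): for real `b` and `4be^{4w₀} = ζ + 2tw₀`,
`Re(tw₀² − be^{4w₀} + ζw₀) = t(α² − β²) − (Re ζ + 2tα)/4 + (Re ζ)α − (Im ζ)β` (`w₀ = α + iβ`;
FMP p. 17: «where we have again used (23)»); = t5's `rodgersTao_re_phase_of_saddleEq` (R2 module),
private copy for olean-independence. [cite: RodgersTaoFMP2020, §2 eq. (23) (FMP p. 12 and p. 17)] -/
private theorem tsw_re_phase_eq {t b : ℝ} {ζ w₀ : ℂ}
    (hE : rodgersTaoSaddleEq t b ζ w₀) :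
    ((t : ℂ) * w₀ ^ 2 - (b : ℂ) * Complex.exp (4 * w₀) + ζ * w₀).re =
      t * (w₀.re ^ 2 - w₀.im ^ 2) - (ζ.re + 2 * t * w₀.re) / 4 + ζ.re * w₀.re - ζ.im * w₀.im := by
  rw [rodgersTaoSaddleEq] at hE
  have hre := congrArg Complex.re hE
  have h4re : ((4 : ℂ) * w₀).re = 4 * w₀.re := by simp
  have h4im : ((4 : ℂ) * w₀).im = 4 * w₀.im := by simp
  simp only [Complex.mul_re, Complex.mul_im, Complex.exp_re, Complex.exp_im, h4re, h4im,
    Complex.add_re, Complex.ofReal_re, Complex.ofReal_im, Complex.re_ofNat,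
    Complex.im_ofNat, mul_zero, sub_zero, zero_mul, add_zero] at hre
  have hb : ((b : ℂ) * Complex.exp (4 * w₀)).re =
      b * (Real.exp (4 * w₀.re) * Real.cos (4 * w₀.im)) := by
    simp only [Complex.mul_re, Complex.exp_re, Complex.exp_im, h4re, h4im, Complex.ofReal_re,
      Complex.ofReal_im, zero_mul, sub_zero]
  simp only [Complex.sub_re, Complex.add_re, Complex.mul_re, Complex.ofReal_re, Complex.ofReal_im,
    zero_mul, sub_zero, sq, Complex.mul_im, hb]
  nlinarith [hre]

/-- **[R1] the complex wrapper** (Rodgers–Tao 2020, §2, FMP p. 19: «from (31) and (23) (and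
Lemma 2.3 (i)) we have `I_t(b, ζ) ≪ exp(Re(tw₀² − ζ/4 − tw₀/2 + ζw₀))`», here with `be^{4w₀}`
kept in the exponent; RH-FREE CONTENT): for `−T₀ ≤ t < 0`, `b ≥ 1`, `ζ ∈ Ω(C, C', C'')`
(`C' ≥ C'₀(T₀)`, `C'' ≥ C''₀(C, C', T₀)`) and every solution `w₀` of (23) in the strip (21),
`‖I_t(b, ζ)‖ ≤ K · exp(Re(tw₀² − be^{4w₀} + ζw₀))`, `K = 2√(π/8) + 8A` with `A` the constant of
eq. (31). Inputs as hypotheses: eq. (31) (`rodgersTao_I_asymp`) and Lemma 2.3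
(`rodgersTao_saddlePoint`, clause (i) `Re(4be^{4w₀}) ≥ 1`, whence `‖be^{4w₀}‖ ≥ 1/4`,
`‖(be^{4w₀})^{−1/2}‖ ≤ 2`, `‖be^{4w₀}‖^{−3/2} ≤ 8`). [cite: RodgersTaoFMP2020, §2 eq. (31) and proof of Lemma 2.1 (FMP pp. 16, 19)] -/
theorem rodgersTao_norm_I_le_exp_re_of (hS : rodgersTao_saddlePoint) (hI : rodgersTao_I_asymp)
    (T₀ : ℝ) :
    ∃ C'₀ : ℝ, 0 < C'₀ ∧ ∀ C' : ℝ, C'₀ ≤ C' → ∀ C : ℝ, ∃ C''₀ K : ℝ, 0 < C''₀ ∧ 0 < K ∧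
      ∀ C'' : ℝ, C''₀ ≤ C'' → ∀ t ∈ Ico (-T₀) 0, ∀ b : ℝ, 1 ≤ b → ∀ ζ ∈ rodgersTaoOmega C C' C'',
        ∀ w₀ ∈ rodgersTaoStrip, rodgersTaoSaddleEq t b ζ w₀ →
          ‖rodgersTaoI t b ζ‖ ≤
            K * Real.exp (((t : ℂ) * w₀ ^ 2 - (b : ℂ) * Complex.exp (4 * w₀) + ζ * w₀).re) := by
  obtain ⟨C₁, A₁, hC₁, -, hS'⟩ := hS T₀
  obtain ⟨C₂, hC₂, hI'⟩ := hI T₀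
  refine ⟨max C₁ C₂, lt_max_of_lt_left hC₁, fun C' hC' C ↦ ?_⟩
  obtain ⟨D₁, A₂, hD₁, -, hS''⟩ := hS' C' (le_trans (le_max_left _ _) hC') C
  obtain ⟨D₂, A, hD₂, hA, hI''⟩ := hI' C' (le_trans (le_max_right _ _) hC') C
  refine ⟨max D₁ D₂, 2 * |Real.sqrt (π / 8)| + 8 * A, lt_max_of_lt_left hD₁, by positivity,
    fun C'' hC'' t ht b hb ζ hζ w₀ hw₀ hE ↦ ?_⟩
  have hΩ1 : ζ ∈ rodgersTaoOmega C C' D₁ :=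
    ⟨le_trans ((le_max_left _ _).trans hC'') hζ.1, hζ.2.1, hζ.2.2⟩
  have hΩ2 : ζ ∈ rodgersTaoOmega C C' D₂ :=
    ⟨le_trans ((le_max_right _ _).trans hC'') hζ.1, hζ.2.1, hζ.2.2⟩
  have hi : 1 ≤ (4 * (b : ℂ) * Complex.exp (4 * w₀)).re :=
    ((hS'' D₁ le_rfl t ht b hb ζ hΩ1).2 w₀ hw₀ hE).1
  have h31 := hI'' D₂ le_rfl t ht b hb ζ hΩ2 w₀ hw₀ hE
  exact tsw_norm_le_of_asymp hA.le (tsw_quarter_le_norm hi) h31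

/-- **[R1] with the exponent in real form** (FMP p. 17/19: `Re(tw₀² − ζ/4 − tw₀/2 + ζw₀)` after
inserting (23)), RH-FREE CONTENT: under the hypotheses of `rodgersTao_norm_I_le_exp_re_of`,
`‖I_t(b, ζ)‖ ≤ K · exp(t(α² − β²) − (Re ζ + 2tα)/4 + (Re ζ)α − (Im ζ)β)`, `w₀ = α + iβ`.
[cite: RodgersTaoFMP2020, §2 proof of Lemma 2.1 (FMP pp. 17, 19)] -/
theorem rodgersTao_norm_I_le_exp_real_of (hS : rodgersTao_saddlePoint) (hI : rodgersTao_I_asymp)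
    (T₀ : ℝ) :
    ∃ C'₀ : ℝ, 0 < C'₀ ∧ ∀ C' : ℝ, C'₀ ≤ C' → ∀ C : ℝ, ∃ C''₀ K : ℝ, 0 < C''₀ ∧ 0 < K ∧
      ∀ C'' : ℝ, C''₀ ≤ C'' → ∀ t ∈ Ico (-T₀) 0, ∀ b : ℝ, 1 ≤ b → ∀ ζ ∈ rodgersTaoOmega C C' C'',
        ∀ w₀ ∈ rodgersTaoStrip, rodgersTaoSaddleEq t b ζ w₀ →
          ‖rodgersTaoI t b ζ‖ ≤
            K * Real.exp (t * (w₀.re ^ 2 - w₀.im ^ 2) - (ζ.re + 2 * t * w₀.re) / 4 +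
              ζ.re * w₀.re - ζ.im * w₀.im) := by
  obtain ⟨C'₀, hC'₀, h⟩ := rodgersTao_norm_I_le_exp_re_of hS hI T₀
  refine ⟨C'₀, hC'₀, fun C' hC' C ↦ ?_⟩
  obtain ⟨C''₀, K, hC''₀, hK, h'⟩ := h C' hC' C
  refine ⟨C''₀, K, hC''₀, hK, fun C'' hC'' t ht b hb ζ hζ w₀ hw₀ hE ↦ ?_⟩
  rw [← tsw_re_phase_eq hE]
  exact h' C'' hC'' t ht b hb ζ hζ w₀ hw₀ hE

/-! ## Bookkeeping for the summands `Q_{t,n}`: `ζ_a = a + y + ix ∈ Ω`, `b = πn² ≥ 1` -/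

/-- For `y = κ log₊ x` with `1 ≤ C' ≤ κ ≤ C`, `x ≥ max(C'', 1)` and `0 ≤ a ≤ 9`, the point
`ζ_a = (a + y) + ix` lies in `Ω(C + 5, C', C'')` (eq. (20); FMP p. 17 applies Lemma 2.3 «with
`ζ = 9 + y + ix`», resp. `5 + y + ix`). [cite: RodgersTaoFMP2020, §2 eq. (20) and p. 17 (FMP pp. 11, 17)] -/
theorem rodgersTao_mem_Omega_shift {C C' C'' x κ a : ℝ} (hC' : 1 ≤ C') (hκ : κ ∈ Icc C' C)
    (hx : C'' ≤ x) (hx1 : 1 ≤ x) (ha : a ∈ Icc (0 : ℝ) 9) :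
    ((a : ℂ) + ((κ * logPlus x : ℝ) : ℂ) + (x : ℂ) * I) ∈ rodgersTaoOmega (C + 5) C' C'' := by
  have hre : ((a : ℂ) + ((κ * logPlus x : ℝ) : ℂ) + (x : ℂ) * I).re = a + κ * logPlus x := by simp
  have him : ((a : ℂ) + ((κ * logPlus x : ℝ) : ℂ) + (x : ℂ) * I).im = x := by simp
  refine ⟨by rw [him]; exact hx, ?_, ?_⟩
  · rw [hre, him]
    have hL := logPlus_nonneg x
    have := mul_le_mul_of_nonneg_right hκ.1 hL
    linarith [ha.1]
  · rw [hre, him]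
    have hL1 : 1 ≤ logPlus x := by
      rw [logPlus_eq, abs_of_pos (by linarith), ← Real.log_exp 1]
      refine Real.log_le_log (Real.exp_pos 1) ?_
      have := Real.exp_one_lt_d9; norm_num at this; linarith
    have hC : 0 ≤ C := by linarith [hκ.1, hκ.2]
    have h1 := mul_le_mul_of_nonneg_right hκ.2 (logPlus_nonneg x)
    nlinarith [h1, ha.2, hL1, hC]

/-- The same point written as `((a + κ log₊ x : ℝ) : ℂ) + x I` (the form used in
`rodgersTao_norm_I_pi_asymp`). [cite: RodgersTaoFMP2020, §2 eq. (20) and p. 17 (FMP pp. 11, 17)] -/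
theorem rodgersTao_mem_Omega_shift' {C C' C'' x κ a : ℝ} (hC' : 1 ≤ C') (hκ : κ ∈ Icc C' C)
    (hx : C'' ≤ x) (hx1 : 1 ≤ x) (ha : a ∈ Icc (0 : ℝ) 9) :
    (((a + κ * logPlus x : ℝ) : ℂ) + (x : ℂ) * I) ∈ rodgersTaoOmega (C + 5) C' C'' := by
  have e : (((a + κ * logPlus x : ℝ) : ℂ) + (x : ℂ) * I) =
      (a : ℂ) + ((κ * logPlus x : ℝ) : ℂ) + (x : ℂ) * I := by push_cast; ring
  rw [e]; exact rodgersTao_mem_Omega_shift hC' hκ hx hx1 ha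

/-- `b = πn² ≥ 1` for `n ≥ 1` (Lemma 2.3 is applied «with `b = πn²`», FMP p. 17), and the cast
identity `(π : ℂ)·(n : ℂ)² = ((πn² : ℝ) : ℂ)` matching `rodgersTaoQ`. [cite: RodgersTaoFMP2020, §2 p. 17 (FMP p. 17)] -/
theorem rodgersTao_one_le_pi_mul_sq {n : ℕ} (hn : 1 ≤ n) : (1 : ℝ) ≤ π * (n : ℝ) ^ 2 := by
  have h1 : (1 : ℝ) ≤ n := by exact_mod_cast hn
  nlinarith [Real.pi_gt_three]

/-- Cast identity for `b = πn²` matching the `rodgersTaoQ` summand (Lemma 2.3 applied «with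
`b = πn²`», FMP p. 17). [cite: RodgersTaoFMP2020, §2 p. 17 (FMP p. 17)] -/
theorem rodgersTao_pi_mul_sq_cast (n : ℕ) :
    (π : ℂ) * (n : ℂ) ^ 2 = ((π * (n : ℝ) ^ 2 : ℝ) : ℂ) := by push_cast; ring

/-- Triangle inequality for the summand: `‖Q_{t,n}‖ ≤ 2π²n⁴‖I_t(πn², 9+y+ix)‖ + 3πn²‖I_t(πn², 5+y+ix)‖`
(display after (32), FMP p. 17). [cite: RodgersTaoFMP2020, §2 display after eq. (32) (FMP p. 17)] -/
theorem rodgersTao_norm_Q_le (t : ℝ) (n : ℕ) (x y : ℝ) :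
    ‖rodgersTaoQ t n x y‖ ≤
      2 * π ^ 2 * (n : ℝ) ^ 4 * ‖rodgersTaoI t (π * (n : ℂ) ^ 2) (9 + y + x * I)‖ +
        3 * π * (n : ℝ) ^ 2 * ‖rodgersTaoI t (π * (n : ℂ) ^ 2) (5 + y + x * I)‖ := by
  unfold rodgersTaoQ
  refine (norm_sub_le _ _).trans (le_of_eq ?_)
  have h1 : ‖(2 * π ^ 2 * (n : ℂ) ^ 4 : ℂ)‖ = 2 * π ^ 2 * (n : ℝ) ^ 4 := by
    rw [show (2 * π ^ 2 * (n : ℂ) ^ 4 : ℂ) = ((2 * π ^ 2 * (n : ℝ) ^ 4 : ℝ) : ℂ) by push_cast; ring,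
      Complex.norm_real, Real.norm_eq_abs, abs_of_nonneg (by positivity)]
  have h2 : ‖(3 * π * (n : ℂ) ^ 2 : ℂ)‖ = 3 * π * (n : ℝ) ^ 2 := by
    rw [show (3 * π * (n : ℂ) ^ 2 : ℂ) = ((3 * π * (n : ℝ) ^ 2 : ℝ) : ℂ) by push_cast; ring,
      Complex.norm_real, Real.norm_eq_abs, abs_of_nonneg (by positivity)]
  rw [norm_mul (2 * π ^ 2 * (n : ℂ) ^ 4 : ℂ), norm_mul (3 * π * (n : ℂ) ^ 2 : ℂ), h1, h2]

end Literature.NumberTheory.LFunctions
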